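import Summits.ResolutionOfSingularities.ResolutionOfSingularities.Theses.WildCones
import HarnessLib

/-!
# Crux `NarrowRunsDie` (stmt-ResolutionOfSingularities-16882) — birth skeleton (BC3), line `birth`

Route `ResolutionOfSingularities/WildCones`, crux #2 (rank 2, difficulty L):
`NarrowRunsDie` = "for `p` odd, `n ≥ 3`, `κ` perfect of characteristic `p`: there is no infinite
run `m ↦ run c₀ i t m` of the point-blow-up dynamics of a height-one atom `z^p = a(u_1,…,u_n)`
(blow up the closed point, chart `i m`, divide by `u_(i m)^p`, translate by `t m`, delete
`p`-th-power monomials) all of whose states are isolated (`κ[[u]]/(∂a)` finite) of multiplicity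
`p`, of cleaned order EXACTLY `p`, with one-dimensional cone-invariance space
`L(a_p) = {w | a_p(X + wS) = a_p(X) + a_p(w) S^p}` (`dL = 1`)".

## The cut (the planner's foreseen two-layer split, typed): SatelliteExclusion → FreeRunArc

The route header (TWO-LAYER PLAN) foresees `NarrowRunsDie ⇐ SatelliteExclusion → FreeRunArc`, and
the two route-review refuters sketched exactly this proof (item evidence `REVIEW-WildCones.md`,
`WildCones_engine_review.md` §3, `SKETCH-NarrowRunsDie.md`). In the coefficient calculus the
centre of blow-up `m + 1` lies on the strict transform of the exceptional divisor
`E_m = {u_(i m) = 0}` of blow-up `m` iff the chart changes AND the new translation has no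
`u_(i m)`-component: `i (m+1) ≠ i m ∧ t (m+1) (i m) = 0`. So

* **FREE RUN** := `∀ m, i (m + 1) = i m ∨ t (m + 1) (i m) ≠ 0` (every centre lies on the newest
  exceptional component only; by induction it is then off every older one).

* `stub_narrowIsFree` — **SATELLITE EXCLUSION (size M; the crux's named risk, isolated).** Under
  the crux hypotheses (all states isolated of multiplicity `p`, cleaned order `p`, `dL = 1`) the
  run is free. Paper proof (refuter g2's key lemma, checked here on paper against the `let`
  calculus): (a) NEAR DIRECTIONS ARE INVARIANCE DIRECTIONS — if `run (m+1)` again has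
  multiplicity `p`, then restricting the transformed series to `u_(i m) = 0` shows
  `clean(G_m(v_m + h))` has order `≥ p` for `h ∈ H := {h_(i m) = 0}`, where `G_m = cone (run m)`
  and `v_m := e_(i m) + Σ_(j ≠ i m) t m j • e_j`; a polynomial of degree `≤ p` in `h` whose
  non-`p`-th-power monomials of degree `< p` vanish is `G_m(v_m) + G_m(h)`, and homogenising
  along `v_m` gives the polynomial identity `G_m(X + v_m S) = G_m(X) + G_m(v_m) S^p`, i.e.
  `v_m ∈ Linv (run m)`; (b) KEY LEMMA — `G_(m+1)|_H = clean_(n-1)(G_m|_H)` differs from `G_m|_H`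
  by `p`-th powers `Σ b_j h_j^p`, which are additive in characteristic `p`, so every
  `w ∈ Linv (run (m+1)) ∩ H` satisfies the `Linv (run m)` identity on `H`, and by (a) for `v_m`
  (`v_m ∉ H`) on all of `κ^n`: `w ∈ Linv (run m) ⊆ span = κ • v_m` (`dL = 1`), whence `w = 0`
  (compare `i m`-coordinates); (c) `v_(m+1) ∈ Linv (run (m+1))` by (a) one stage later, it is
  non-zero (its `i (m+1)`-coordinate is `1`), so `v_(m+1) ∉ H`: `i (m+1) = i m` or
  `t (m+1) (i m) ≠ 0`. Uses `MultP` at `m, m+1, m+2`, `OrdP`/`dL = 1` at `m`; nothing about `p`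
  odd or `n ≥ 3` (the stub is stated for every prime and every `n ≥ 1`). Why it might still fail
  in Lean-sized reality: only through a slip in the dictionary above (the `tr`/`bl`/`clean`
  conventions), which is why it is a stub and not folded into the assembly.
* `stub_freeRunArc` — **THE ARC LEMMA (size L; load-bearing).** Along an infinite FREE run all of
  whose states have multiplicity `p`, the Jacobian ideal of the start state dies on a smooth
  formal arc: there is a SURJECTIVE `κ`-algebra map `φ : κ[[u_1..u_n]] → κ[[x]]` (= evaluation
  along a smooth formal arc `γ`, `γ(0) = 0`; surjective = smooth) killing every `∂_j a₀`. Paper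
  proof: a free infinite sequence of infinitely near points is the sequence of infinitely near
  points of a unique smooth formal arc `Γ` of the ambient `Spf κ[[z,u]]` (the `z`-shifts of the
  cleaning steps are ambient automorphisms; the dynamics never visits the `z`-direction); in
  coordinates adapted to `Γ` the blow-ups are monomial and "multiplicity `p` at every
  infinitely near point of `Γ`" reads `ord f_α + (m+1)(|α| - p) ≥ 0` for all `m`, forcing
  `f_α = 0` for `|α| < p`, i.e. `z^p + a₀ ∈ I_Γ^p`; derivations lower the power by one, so
  `∂_j a₀ ∈ I_Γ^(p-1) ⊆ I_Γ`, and `∂_j a₀ ∈ κ[[u]]` vanishes on the projection `γ` of `Γ`, a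
  smooth arc because the tangent of `Γ` has `u_(i 0)`-component `1`. This is the coefficient-
  calculus twin of the tree's formal-axis argument for near chains
  (`Literature.AlgebraicGeometry.Resolution.FormalAxisOfNearChain`: adapted coordinates
  `z⁽ᴺ⁾`, Krull `le_of_forall_le_sup_pow`, `exists_prime_ne_maximalIdeal_map_le_pow`;
  CossartPiltant2008 Prop. 4.4 "standard arguments"), in arbitrary dimension and with the
  explicit `let` dynamics in place of `IsBlowup`/`IsNear`. Why it might fail: the moving frame
  (chart changes `i (m+1) ≠ i m` with `t (m+1) (i m) ≠ 0` are allowed in a free run) makes the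
  adapted-coordinate bookkeeping a genuine covariance lemma for `clean ∘ tr ∘ dv ∘ bl`, not a
  one-liner; no mathematical obstruction is known (char-free, all `n ≥ 1`).
* The assembly `NarrowRunsDie_of : Sig.stub_narrowIsFree → Sig.stub_freeRunArc → NarrowRunsDie`
  is PROVED (no `sorry` in its own term): satellite exclusion makes the run free, the arc lemma
  gives `φ` surjective with `(∂a₀) ⊆ ker φ`, so `κ[[u]]/(∂a₀) ↠ κ[[x]]`; `Isol (run 0)` makes
  `κ[[x]]` module-finite over `κ`, hence integral, hence a field
  (`isField_of_isIntegral_of_isField'`) — but `κ[[x]]` is a DVR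
  (`IsDiscreteValuationRing.not_isField`). `NarrowRunsDie_proof : NarrowRunsDie` plugs the two
  `stub_*` in (its only `sorry`s are theirs).

Disproof used: none on file for this crux (`ledger crux ls stmt-ResolutionOfSingularities-16882`:
no workfiles before this one; `ledger negatives --problem ResolutionOfSingularities`: 1 entry,
`DefectlessFrames` (valuation-theoretic, unrelated to the coefficient dynamics), 2026-08-17).
Grounding on file: CJS2020 Thm 6.35 / Cor 6.37 (`e = 1`) covers the crux for `2p ≥ n + 2`
(vendored `Literature.AlgebraicGeometry.Resolution.CJS2020_noInfiniteNearChain_eOne`); this line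
is dimension-free and does not use it.
-/

noncomputable section

-- single-problem summit: the doubled namespace component `ResolutionOfSingularities` is forced
set_option linter.dupNamespace false

open Summit.ResolutionOfSingularities.ResolutionOfSingularities.Theses.WildCones (NarrowRunsDie)

namespace Summit.ResolutionOfSingularities.ResolutionOfSingularities.Cruxes.NarrowRunsDie.Lines.Birth

/-! ## The two stub STATEMENTS by name (`Sig.stub_<name>`, the registered-signature convention of
birth skeletons: the composition `NarrowRunsDie_of` takes exactly these as hypotheses). Both are
typed over the route's inlined `let` calculus VERBATIM (same `clean bl ord dv tr step run ser pd
jac Isol MultP [OrdP cone Linv dL]` as `WildCones.NarrowRunsDie` / `IsolatedForcedTermination`),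
so they compose with the crux by ζ-reduction alone. -/

/-- Statement of `stub_narrowIsFree` — **satellite exclusion**: for every prime `p`, `n ≥ 1` and
perfect `κ` of characteristic `p`, a run of the point-blow-up dynamics all of whose states are
isolated of multiplicity `p`, of cleaned order exactly `p` and with `dL = 1`, is FREE: at every
stage the next centre is off the strict transform of the previous exceptional divisor
`{u_(i m) = 0}`, i.e. `i (m+1) = i m ∨ t (m+1) (i m) ≠ 0`.
[cite: CossartJannsenSaito2020, Thm. 3.14 and Cor. 6.37; arXiv:1802.05010, §1] -/
def Sig.stub_narrowIsFree : Prop :=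
  ∀ p : ℕ, p.Prime → ∀ n : ℕ, 0 < n → ∀ (κ : Type) [Field κ] [CharP κ p] [PerfectField κ]
    (c₀ : (Fin n → ℕ) → κ) (i : ℕ → Fin n) (t : ℕ → Fin n → κ),
    let clean : ((Fin n → ℕ) → κ) → ((Fin n → ℕ) → κ) := fun c A => @ite κ (∀ j, p ∣ A j) (Classical.dec _) 0 (c A);
    let bl : Fin n → ((Fin n → ℕ) → κ) → ((Fin n → ℕ) → κ) := fun i c B => @ite κ (Finset.sum (Finset.univ.erase i) (fun j => B j) ≤ B i) (Classical.dec _) (c (Function.update B i (B i - Finset.sum (Finset.univ.erase i) (fun j => B j)))) 0;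
    let ord : ((Fin n → ℕ) → κ) → ℕ := fun c => sInf {m : ℕ | ∃ A, c A ≠ 0 ∧ m = Finset.sum Finset.univ (fun j => A j)};
    let dv : Fin n → ℕ → ((Fin n → ℕ) → κ) → ((Fin n → ℕ) → κ) := fun i s c B => c (Function.update B i (B i + s));
    let tr : Fin n → (Fin n → κ) → ℕ → ((Fin n → ℕ) → κ) → ((Fin n → ℕ) → κ) := fun i τ s c B => Finset.sum (Fintype.piFinset (fun _ : Fin n => Finset.range (B i + s + 1))) (fun D => @ite κ (D i = 0) (Classical.dec _) (c (B + D) * Finset.prod (Finset.univ.erase i) (fun j => ((Nat.choose (B j + D j) (B j) : ℕ) : κ) * τ j ^ (D j))) 0);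
    let step : Fin n → (Fin n → κ) → ((Fin n → ℕ) → κ) → ((Fin n → ℕ) → κ) := fun i τ c => clean (tr i τ (@ite ℕ (p ≤ ord (clean c)) (Classical.dec _) p 0) (dv i (@ite ℕ (p ≤ ord (clean c)) (Classical.dec _) p 0) (bl i (clean c))));
    let run : ((Fin n → ℕ) → κ) → (ℕ → Fin n) → (ℕ → Fin n → κ) → ℕ → ((Fin n → ℕ) → κ) := fun c₀ i t m => @Nat.rec (fun _ => (Fin n → ℕ) → κ) c₀ (fun m c => step (i m) (t m) c) m;
    let ser : ((Fin n → ℕ) → κ) → MvPowerSeries (Fin n) κ := fun c => show MvPowerSeries (Fin n) κ from fun A : Fin n →₀ ℕ => clean c ⇑A;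
    let pd : Fin n → MvPowerSeries (Fin n) κ → MvPowerSeries (Fin n) κ := fun i f => show MvPowerSeries (Fin n) κ from fun A : Fin n →₀ ℕ => ((A i + 1 : ℕ) : κ) * f (A + Finsupp.single i 1);
    let jac : ((Fin n → ℕ) → κ) → Ideal (MvPowerSeries (Fin n) κ) := fun c => Ideal.span (Set.range (fun i => pd i (ser c)));
    let Isol : ((Fin n → ℕ) → κ) → Prop := fun c => Module.Finite κ (MvPowerSeries (Fin n) κ ⧸ jac c);
    let MultP : ((Fin n → ℕ) → κ) → Prop := fun c => (∃ A, clean c A ≠ 0) ∧ ∀ A, clean c A ≠ 0 → p ≤ Finset.sum Finset.univ (fun j => A j);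
    let OrdP : ((Fin n → ℕ) → κ) → Prop := fun c => ∃ A, clean c A ≠ 0 ∧ Finset.sum Finset.univ (fun j => A j) = p;
    let cone : ((Fin n → ℕ) → κ) → MvPolynomial (Fin n) κ := fun c => Finset.sum (Fintype.piFinset (fun _ : Fin n => Finset.range (p + 1))) (fun A => @ite (MvPolynomial (Fin n) κ) (Finset.sum Finset.univ (fun j => A j) = p) (Classical.dec _) (MvPolynomial.monomial (Finsupp.equivFunOnFinite.symm A) (clean c A)) 0);
    let Linv : ((Fin n → ℕ) → κ) → Set (Fin n → κ) := fun c => {w : Fin n → κ | MvPolynomial.aeval (fun j : Fin n => (MvPolynomial.X (some j) : MvPolynomial (Option (Fin n)) κ) + MvPolynomial.C (w j) * MvPolynomial.X none) (cone c) = MvPolynomial.rename some (cone c) + MvPolynomial.C (MvPolynomial.eval w (cone c)) * (MvPolynomial.X none) ^ p};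
    let dL : ((Fin n → ℕ) → κ) → ℕ := fun c => Module.finrank κ (Submodule.span κ (Linv c));
    (∀ m, Isol (run c₀ i t m) ∧ MultP (run c₀ i t m)) →
    (∀ m, OrdP (run c₀ i t m) ∧ dL (run c₀ i t m) = 1) →
    ∀ m, i (m + 1) = i m ∨ t (m + 1) (i m) ≠ 0

/-- Statement of `stub_freeRunArc` — **the arc lemma for free runs**: for every prime `p`,
`n ≥ 1` and perfect `κ` of characteristic `p`, if every state of the run has multiplicity `p`
(`MultP`) and the run is free, then the Jacobian ideal `(∂_1 a₀, …, ∂_n a₀)` of the (cleaned)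
start series `a₀ = ser (run c₀ i t 0)` is killed by a SURJECTIVE `κ`-algebra homomorphism
`κ[[u_1..u_n]] → κ[[x]]` (evaluation along a smooth formal arc through the origin: the
projection of the formal arc of the ambient whose infinitely near points the free run visits,
along which `z^p + a₀` is equimultiple of multiplicity `p`).
[cite: CossartPiltant2008, Prop. 4.4 (proof, "standard arguments"); CossartJannsenSaito2020, Cor. 6.37] -/
def Sig.stub_freeRunArc : Prop :=
  ∀ p : ℕ, p.Prime → ∀ n : ℕ, 0 < n → ∀ (κ : Type) [Field κ] [CharP κ p] [PerfectField κ]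
    (c₀ : (Fin n → ℕ) → κ) (i : ℕ → Fin n) (t : ℕ → Fin n → κ),
    let clean : ((Fin n → ℕ) → κ) → ((Fin n → ℕ) → κ) := fun c A => @ite κ (∀ j, p ∣ A j) (Classical.dec _) 0 (c A);
    let bl : Fin n → ((Fin n → ℕ) → κ) → ((Fin n → ℕ) → κ) := fun i c B => @ite κ (Finset.sum (Finset.univ.erase i) (fun j => B j) ≤ B i) (Classical.dec _) (c (Function.update B i (B i - Finset.sum (Finset.univ.erase i) (fun j => B j)))) 0;
    let ord : ((Fin n → ℕ) → κ) → ℕ := fun c => sInf {m : ℕ | ∃ A, c A ≠ 0 ∧ m = Finset.sum Finset.univ (fun j => A j)};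
    let dv : Fin n → ℕ → ((Fin n → ℕ) → κ) → ((Fin n → ℕ) → κ) := fun i s c B => c (Function.update B i (B i + s));
    let tr : Fin n → (Fin n → κ) → ℕ → ((Fin n → ℕ) → κ) → ((Fin n → ℕ) → κ) := fun i τ s c B => Finset.sum (Fintype.piFinset (fun _ : Fin n => Finset.range (B i + s + 1))) (fun D => @ite κ (D i = 0) (Classical.dec _) (c (B + D) * Finset.prod (Finset.univ.erase i) (fun j => ((Nat.choose (B j + D j) (B j) : ℕ) : κ) * τ j ^ (D j))) 0);
    let step : Fin n → (Fin n → κ) → ((Fin n → ℕ) → κ) → ((Fin n → ℕ) → κ) := fun i τ c => clean (tr i τ (@ite ℕ (p ≤ ord (clean c)) (Classical.dec _) p 0) (dv i (@ite ℕ (p ≤ ord (clean c)) (Classical.dec _) p 0) (bl i (clean c))));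
    let run : ((Fin n → ℕ) → κ) → (ℕ → Fin n) → (ℕ → Fin n → κ) → ℕ → ((Fin n → ℕ) → κ) := fun c₀ i t m => @Nat.rec (fun _ => (Fin n → ℕ) → κ) c₀ (fun m c => step (i m) (t m) c) m;
    let ser : ((Fin n → ℕ) → κ) → MvPowerSeries (Fin n) κ := fun c => show MvPowerSeries (Fin n) κ from fun A : Fin n →₀ ℕ => clean c ⇑A;
    let pd : Fin n → MvPowerSeries (Fin n) κ → MvPowerSeries (Fin n) κ := fun i f => show MvPowerSeries (Fin n) κ from fun A : Fin n →₀ ℕ => ((A i + 1 : ℕ) : κ) * f (A + Finsupp.single i 1);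
    let MultP : ((Fin n → ℕ) → κ) → Prop := fun c => (∃ A, clean c A ≠ 0) ∧ ∀ A, clean c A ≠ 0 → p ≤ Finset.sum Finset.univ (fun j => A j);
    (∀ m, MultP (run c₀ i t m)) →
    (∀ m, i (m + 1) = i m ∨ t (m + 1) (i m) ≠ 0) →
    ∃ φ : MvPowerSeries (Fin n) κ →ₐ[κ] PowerSeries κ,
      Function.Surjective φ ∧ ∀ j : Fin n, φ (pd j (ser (run c₀ i t 0))) = 0

/-! ## The stubs -/

/-- **STUB (size M).** Satellite exclusion for `dL = 1` runs — see `Sig.stub_narrowIsFree` and the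
module docstring (near directions are invariance directions; `Linv (run (m+1)) ∩ {w_(i m) = 0} = 0`
because `G_(m+1)|_H` and `G_m|_H` differ by additive `p`-th powers).
[cite: CossartJannsenSaito2020, Thm. 3.14; arXiv:1802.05010, §1] -/
theorem stub_narrowIsFree : Sig.stub_narrowIsFree := by
  sorry

/-- **STUB (size L, load-bearing).** The arc lemma for free multiplicity-`p` runs — see
`Sig.stub_freeRunArc` and the module docstring (free run = infinitely near points of one smooth
formal arc `Γ`; equimultiplicity along `Γ` gives `z^p + a₀ ∈ I_Γ^p`, so `∂_j a₀ ∈ I_Γ`).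
[cite: CossartPiltant2008, Prop. 4.4; CossartJannsenSaito2020, Cor. 6.37] -/
theorem stub_freeRunArc : Sig.stub_freeRunArc := by
  sorry

/-! ## The finiteness contradiction (proved) -/

/-- If `R ⧸ span S` is module-finite over the field `κ` and a SURJECTIVE `κ`-algebra map
`R → κ[[x]]` kills `S`, contradiction: `κ[[x]]` would be module-finite over `κ`, hence integral,
hence a field — but it is a discrete valuation ring. [folklore] -/
theorem false_of_moduleFinite_quotient_of_surjective {κ R : Type} [Field κ] [CommRing R]
    [Algebra κ R] {S : Set R} (hfin : Module.Finite κ (R ⧸ Ideal.span S))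
    (φ : R →ₐ[κ] PowerSeries κ) (hφ : Function.Surjective φ) (hS : ∀ s ∈ S, φ s = 0) : False := by
  have hker : ∀ a ∈ Ideal.span S, φ a = 0 := by
    intro a ha
    have h : Ideal.span S ≤ RingHom.ker φ :=
      Ideal.span_le.mpr fun s hs => RingHom.mem_ker.mpr (hS s hs)
    exact RingHom.mem_ker.mp (h ha)
  let ψ : (R ⧸ Ideal.span S) →ₐ[κ] PowerSeries κ := Ideal.Quotient.liftₐ (Ideal.span S) φ hker
  have hψ : Function.Surjective ψ := by
    intro y
    obtain ⟨x, rfl⟩ := hφ y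
    exact ⟨Ideal.Quotient.mk (Ideal.span S) x, rfl⟩
  haveI : Module.Finite κ (PowerSeries κ) := Module.Finite.of_surjective ψ.toLinearMap hψ
  haveI : Algebra.IsIntegral κ (PowerSeries κ) := Algebra.IsIntegral.of_finite κ (PowerSeries κ)
  exact IsDiscreteValuationRing.not_isField (PowerSeries κ)
    (isField_of_isIntegral_of_isField' (R := κ) (S := PowerSeries κ) (Field.toIsField κ))

/-! ## The composition (kernel-checked; no `sorry` in its own term) -/

/-- **`NarrowRunsDie` from the two stub statements** — the assembly, PROVED: at a prime `p ≠ 2`,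
`n ≥ 3` (so `0 < n`), satellite exclusion makes the narrow run free; the arc lemma produces a
surjective `φ : κ[[u]] →ₐ[κ] κ[[x]]` killing the generators `∂_j a₀` of the Jacobian ideal of the
start state; isolatedness of the start state (`Isol (run c₀ i t 0)`) then contradicts
`false_of_moduleFinite_quotient_of_surjective`. [cite: CossartJannsenSaito2020, Cor. 6.37] -/
theorem NarrowRunsDie_of : Sig.stub_narrowIsFree → Sig.stub_freeRunArc → NarrowRunsDie := by
  intro h₁ h₂ p hp hp2 n hn κ _ _ _ c₀ i t clean bl ord dv tr step run ser pd jac Isol MultP OrdP cone Linv dL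
    hall hnar
  have hn0 : 0 < n := by omega
  have hfree : ∀ m, i (m + 1) = i m ∨ t (m + 1) (i m) ≠ 0 := h₁ p hp n hn0 κ c₀ i t hall hnar
  obtain ⟨φ, hφ, hker⟩ := h₂ p hp n hn0 κ c₀ i t (fun m => (hall m).2) hfree
  exact false_of_moduleFinite_quotient_of_surjective (hall 0).1 φ hφ (Set.forall_mem_range.mpr hker)

/-- **The crux `NarrowRunsDie`, assembled from the two registered stubs** (the skeleton in its
final shape: `NarrowRunsDie_of` with the `stub_*` plugged in; the only `sorry`s in its closure are
the two stubs, none of its own). -/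
theorem NarrowRunsDie_proof : NarrowRunsDie :=
  NarrowRunsDie_of stub_narrowIsFree stub_freeRunArc

end Summit.ResolutionOfSingularities.ResolutionOfSingularities.Cruxes.NarrowRunsDie.Lines.Birth

end
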